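import Summits.CriticalPhenomena.PercolationContinuityZ3.Theorems.PercNearOneGluingNoHeavyQuantLongTailQuintHubAlgE
import Summits.CriticalPhenomena.PercolationContinuityZ3.Theorems.PercNearOneGluingNoHeavyQuantLongTailQuintHubAlgG
import Summits.CriticalPhenomena.PercolationContinuityZ3.Theorems.PercNearOneGluingNoHeavyQuantLongTailQuintHubAlgK
import HarnessLib

/-!
# QUANT lane R8, T-DEC: ALGEBRA OF THE LONG-TAIL QUINT HUB IN `(lo, K)` UNITS, PART 2 — the route capacities of the width-5 sub-floor hub
# `S(γ₁) ∗ ⋯ ∗ S(γ₅)` of shape `{lo, lo+K; γ}`, `2lo ≤ K ≤ 4lo`, as used by the route file (census-1 gen 35)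

builds on p205010 (kernel theorem, internal audit signed; external expert review pending)

Support file (`--supports stmt-CriticalPhenomena-4575`), QUANT lane seat prim-quant-census-1 (gen 35); memo
`run/shared/lean/prim/quant/prim-quant-census-1/g35/QUADHUB-G35.md` §5.  Theorems only, standard axioms, no sorries.  The width-5 twin of
`…QuantLongTailQuadHubAlgK`: the closed forms of `…QuantLongTailQuintHubAlg{A,C1,C2,E,G}` (K-units, worst credit) transported to the route file's variables
(`lo, K, D = T − 10lo`, gates `gᵢ` with `lo ≤ Kgᵢ`, masses `u₀..u₄` of the atoms `5lo + sK`) with the monotone reduction in the credit, AND the three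
DERIVED credit forms: the credit capacity of each route follows from its floor core by a one-line comparison of thresholds
(`u_t/u_s ≥ (S+10c)/(5−5c−S)` beats `S/(3−S)`, `S/(4−S)`, `(S−2)/(4−S)` on the regime since `S ≤ 5(1−c)` and `c ≥ 1/4`), so no certificate is needed
for them.
* `quintHub_capGK` (`(D+10lo)(u₀+u₄) ≤ 5(lo+K)u₄`, `2K ≤ D`); `quintHub_capHK` (`D·u₀ ≤ (4K−D)u₄`, derived from G); `quintHub_capEK`
  (`(D+10lo)(u₁+u₃) ≤ 5(lo+K)u₃`, `2K ≤ D`); `quintHub_capFK` (`(D−2K)u₁ ≤ (4K−D)u₃`, derived from E).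

HONEST STATUS.  Algebra only; `SiblingStep`, `GluedDominatedMass`, `SDECConvClosed`, `FarTreeRow` OPEN; RATE class (log\*) / honest sentence of
`run/shared/lean/prim/quant/README.md` unchanged.  [this work].  Nothing here is cited as a published result.  The gluing rows served
[cite: KozmaNitzan2024, Conjecture 3 (p. 15)]; product measure [cite: Grimmett1999, §1.3 p. 10].
-/

noncomputable section

namespace Summit.CriticalPhenomena.PercolationContinuityZ3.Theorems
namespace Quant
namespace LawDec

/-! ### The two-low routes -/

set_option maxHeartbeats 800000 in
/-- **floor capacity of `5lo → 5lo+4K`** (two-low regime `2K ≤ D ≤ K·Λ − 5lo`): `(D + 10lo)(u₀+u₄) ≤ 5(lo+K)·u₄` (core G at the worst credit). [this work] -/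
theorem quintHub_capGK (lo K g₁ g₂ g₃ g₄ g₅ D : ℝ) (hlo : 0 < lo) (hK2 : 2 * lo ≤ K) (hK8 : K ≤ 4 * lo)
    (hg₁ : lo ≤ K * g₁) (hg₂ : lo ≤ K * g₂) (hg₃ : lo ≤ K * g₃) (hg₄ : lo ≤ K * g₄) (hg₅ : lo ≤ K * g₅)
    (h11 : g₁ ≤ 1) (h21 : g₂ ≤ 1) (h31 : g₃ ≤ 1) (h41 : g₄ ≤ 1) (h51 : g₅ ≤ 1)
    (hD2 : 2 * K ≤ D) (hDS : D ≤ K * (g₁ + g₂ + g₃ + g₄ + g₅) - 5 * lo) :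
    (D + 10 * lo) * (((1 - g₁) * (1 - g₂) * (1 - g₃) * (1 - g₄) * (1 - g₅))
        + (g₁ * g₂ * g₃ * g₄ * (1 - g₅) + g₁ * g₂ * g₃ * g₅ * (1 - g₄) + g₁ * g₂ * g₄ * g₅ * (1 - g₃) + g₁ * g₃ * g₄ * g₅ * (1 - g₂)
          + g₂ * g₃ * g₄ * g₅ * (1 - g₁)))
      ≤ 5 * (lo + K) * (g₁ * g₂ * g₃ * g₄ * (1 - g₅) + g₁ * g₂ * g₃ * g₅ * (1 - g₄) + g₁ * g₂ * g₄ * g₅ * (1 - g₃) + g₁ * g₃ * g₄ * g₅ * (1 - g₂)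
          + g₂ * g₃ * g₄ * g₅ * (1 - g₁)) := by
  have hK : 0 < K := by linarith
  set c : ℝ := lo / K with hc
  have hcK : c * K = lo := by rw [hc]; field_simp
  have hc4 : 1 / 4 ≤ c := by rw [hc, le_div_iff₀ hK]; linarith
  have hc2 : c ≤ 1 / 2 := by rw [hc, div_le_iff₀ hK]; linarith
  have h1 : c ≤ g₁ := by rw [hc, div_le_iff₀ hK]; linarith
  have h2 : c ≤ g₂ := by rw [hc, div_le_iff₀ hK]; linarith
  have h3 : c ≤ g₃ := by rw [hc, div_le_iff₀ hK]; linarith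
  have h4 : c ≤ g₄ := by rw [hc, div_le_iff₀ hK]; linarith
  have h5 : c ≤ g₅ := by rw [hc, div_le_iff₀ hK]; linarith
  have hg1 : 0 ≤ g₁ := le_trans (by rw [hc]; positivity) h1
  have hg2 : 0 ≤ g₂ := le_trans (by rw [hc]; positivity) h2
  have hg3 : 0 ≤ g₃ := le_trans (by rw [hc]; positivity) h3
  have hg4 : 0 ≤ g₄ := le_trans (by rw [hc]; positivity) h4
  have hg5 : 0 ≤ g₅ := le_trans (by rw [hc]; positivity) h5
  obtain ⟨n0, n1, n2, n3, n4⟩ := quintHub_masses_nonneg g₁ g₂ g₃ g₄ g₅ hg1 hg2 hg3 hg4 hg5 h11 h21 h31 h41 h51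
  set U0 := ((1 - g₁) * (1 - g₂) * (1 - g₃) * (1 - g₄) * (1 - g₅)) with hU0
  set U1 := (g₁ * (1 - g₂) * (1 - g₃) * (1 - g₄) * (1 - g₅) + g₂ * (1 - g₁) * (1 - g₃) * (1 - g₄) * (1 - g₅)
          + g₃ * (1 - g₁) * (1 - g₂) * (1 - g₄) * (1 - g₅) + g₄ * (1 - g₁) * (1 - g₂) * (1 - g₃) * (1 - g₅)
          + g₅ * (1 - g₁) * (1 - g₂) * (1 - g₃) * (1 - g₄)) with hU1
  set U2 := (g₁ * g₂ * (1 - g₃) * (1 - g₄) * (1 - g₅) + g₁ * g₃ * (1 - g₂) * (1 - g₄) * (1 - g₅) + g₁ * g₄ * (1 - g₂) * (1 - g₃) * (1 - g₅)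
          + g₁ * g₅ * (1 - g₂) * (1 - g₃) * (1 - g₄) + g₂ * g₃ * (1 - g₁) * (1 - g₄) * (1 - g₅) + g₂ * g₄ * (1 - g₁) * (1 - g₃) * (1 - g₅)
          + g₂ * g₅ * (1 - g₁) * (1 - g₃) * (1 - g₄) + g₃ * g₄ * (1 - g₁) * (1 - g₂) * (1 - g₅) + g₃ * g₅ * (1 - g₁) * (1 - g₂) * (1 - g₄)
          + g₄ * g₅ * (1 - g₁) * (1 - g₂) * (1 - g₃)) with hU2
  set U3 := (g₁ * g₂ * g₃ * (1 - g₄) * (1 - g₅) + g₁ * g₂ * g₄ * (1 - g₃) * (1 - g₅) + g₁ * g₂ * g₅ * (1 - g₃) * (1 - g₄)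
          + g₁ * g₃ * g₄ * (1 - g₂) * (1 - g₅) + g₁ * g₃ * g₅ * (1 - g₂) * (1 - g₄) + g₁ * g₄ * g₅ * (1 - g₂) * (1 - g₃)
          + g₂ * g₃ * g₄ * (1 - g₁) * (1 - g₅) + g₂ * g₃ * g₅ * (1 - g₁) * (1 - g₄) + g₂ * g₄ * g₅ * (1 - g₁) * (1 - g₃)
          + g₃ * g₄ * g₅ * (1 - g₁) * (1 - g₂)) with hU3
  set U4 := (g₁ * g₂ * g₃ * g₄ * (1 - g₅) + g₁ * g₂ * g₃ * g₅ * (1 - g₄) + g₁ * g₂ * g₄ * g₅ * (1 - g₃) + g₁ * g₃ * g₄ * g₅ * (1 - g₂)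
          + g₂ * g₃ * g₄ * g₅ * (1 - g₁)) with hU4
  clear_value c U0 U1 U2 U3 U4
  have hS2 : 5 * c + 2 ≤ g₁ + g₂ + g₃ + g₄ + g₅ := by
    have : (5 * c + 2) * K ≤ (g₁ + g₂ + g₃ + g₄ + g₅) * K := by linarith [hcK]
    exact le_of_mul_le_mul_right this hK
  have hG := quintHub_coreG g₁ g₂ g₃ g₄ g₅ c hc4 hc2 h1 h2 h3 h4 h5 h11 h21 h31 h41 h51 hS2
  rw [← hU0, ← hU4] at hG
  have hDK : D + 10 * lo ≤ K * (g₁ + g₂ + g₃ + g₄ + g₅ + 5 * c) := by linarith [hcK]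
  have h6 := mul_le_mul_of_nonneg_right hDK (add_nonneg n0 n4)
  have h7 := mul_le_mul_of_nonneg_left hG hK.le
  have e : 5 * (lo + K) * U4 = K * ((g₁ + g₂ + g₃ + g₄ + g₅ + 5 * c) * U4) + K * ((5 - (g₁ + g₂ + g₃ + g₄ + g₅)) * U4) := by
    rw [← hcK]; ring
  rw [e]; linarith [h6, h7]

set_option maxHeartbeats 800000 in
/-- **credit capacity of `5lo → 5lo+4K`**: `D·u₀ ≤ (4K − D)·u₄` for `2K ≤ D ≤ K·Λ − 5lo` — DERIVED from core G: `u₄/u₀ ≥ (S+10c)/(5−5c−S) ≥ S/(4−S)`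
since `S(1+5c) ≤ 40c`. [this work] -/
theorem quintHub_capHK (lo K g₁ g₂ g₃ g₄ g₅ D : ℝ) (hlo : 0 < lo) (hK2 : 2 * lo ≤ K) (hK8 : K ≤ 4 * lo)
    (hg₁ : lo ≤ K * g₁) (hg₂ : lo ≤ K * g₂) (hg₃ : lo ≤ K * g₃) (hg₄ : lo ≤ K * g₄) (hg₅ : lo ≤ K * g₅)
    (h11 : g₁ ≤ 1) (h21 : g₂ ≤ 1) (h31 : g₃ ≤ 1) (h41 : g₄ ≤ 1) (h51 : g₅ ≤ 1)
    (hD2 : 2 * K ≤ D) (hDS : D ≤ K * (g₁ + g₂ + g₃ + g₄ + g₅) - 5 * lo) :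
    D * ((1 - g₁) * (1 - g₂) * (1 - g₃) * (1 - g₄) * (1 - g₅))
      ≤ (4 * K - D) * (g₁ * g₂ * g₃ * g₄ * (1 - g₅) + g₁ * g₂ * g₃ * g₅ * (1 - g₄) + g₁ * g₂ * g₄ * g₅ * (1 - g₃) + g₁ * g₃ * g₄ * g₅ * (1 - g₂)
          + g₂ * g₃ * g₄ * g₅ * (1 - g₁)) := by
  have hK : 0 < K := by linarith
  set c : ℝ := lo / K with hc
  have hcK : c * K = lo := by rw [hc]; field_simp
  have hc4 : 1 / 4 ≤ c := by rw [hc, le_div_iff₀ hK]; linarith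
  have hc2 : c ≤ 1 / 2 := by rw [hc, div_le_iff₀ hK]; linarith
  have h1 : c ≤ g₁ := by rw [hc, div_le_iff₀ hK]; linarith
  have h2 : c ≤ g₂ := by rw [hc, div_le_iff₀ hK]; linarith
  have h3 : c ≤ g₃ := by rw [hc, div_le_iff₀ hK]; linarith
  have h4 : c ≤ g₄ := by rw [hc, div_le_iff₀ hK]; linarith
  have h5 : c ≤ g₅ := by rw [hc, div_le_iff₀ hK]; linarith
  have hg1 : 0 ≤ g₁ := le_trans (by rw [hc]; positivity) h1
  have hg2 : 0 ≤ g₂ := le_trans (by rw [hc]; positivity) h2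
  have hg3 : 0 ≤ g₃ := le_trans (by rw [hc]; positivity) h3
  have hg4 : 0 ≤ g₄ := le_trans (by rw [hc]; positivity) h4
  have hg5 : 0 ≤ g₅ := le_trans (by rw [hc]; positivity) h5
  obtain ⟨n0, n1, n2, n3, n4⟩ := quintHub_masses_nonneg g₁ g₂ g₃ g₄ g₅ hg1 hg2 hg3 hg4 hg5 h11 h21 h31 h41 h51
  set U0 := ((1 - g₁) * (1 - g₂) * (1 - g₃) * (1 - g₄) * (1 - g₅)) with hU0
  set U1 := (g₁ * (1 - g₂) * (1 - g₃) * (1 - g₄) * (1 - g₅) + g₂ * (1 - g₁) * (1 - g₃) * (1 - g₄) * (1 - g₅)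
          + g₃ * (1 - g₁) * (1 - g₂) * (1 - g₄) * (1 - g₅) + g₄ * (1 - g₁) * (1 - g₂) * (1 - g₃) * (1 - g₅)
          + g₅ * (1 - g₁) * (1 - g₂) * (1 - g₃) * (1 - g₄)) with hU1
  set U2 := (g₁ * g₂ * (1 - g₃) * (1 - g₄) * (1 - g₅) + g₁ * g₃ * (1 - g₂) * (1 - g₄) * (1 - g₅) + g₁ * g₄ * (1 - g₂) * (1 - g₃) * (1 - g₅)
          + g₁ * g₅ * (1 - g₂) * (1 - g₃) * (1 - g₄) + g₂ * g₃ * (1 - g₁) * (1 - g₄) * (1 - g₅) + g₂ * g₄ * (1 - g₁) * (1 - g₃) * (1 - g₅)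
          + g₂ * g₅ * (1 - g₁) * (1 - g₃) * (1 - g₄) + g₃ * g₄ * (1 - g₁) * (1 - g₂) * (1 - g₅) + g₃ * g₅ * (1 - g₁) * (1 - g₂) * (1 - g₄)
          + g₄ * g₅ * (1 - g₁) * (1 - g₂) * (1 - g₃)) with hU2
  set U3 := (g₁ * g₂ * g₃ * (1 - g₄) * (1 - g₅) + g₁ * g₂ * g₄ * (1 - g₃) * (1 - g₅) + g₁ * g₂ * g₅ * (1 - g₃) * (1 - g₄)
          + g₁ * g₃ * g₄ * (1 - g₂) * (1 - g₅) + g₁ * g₃ * g₅ * (1 - g₂) * (1 - g₄) + g₁ * g₄ * g₅ * (1 - g₂) * (1 - g₃)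
          + g₂ * g₃ * g₄ * (1 - g₁) * (1 - g₅) + g₂ * g₃ * g₅ * (1 - g₁) * (1 - g₄) + g₂ * g₄ * g₅ * (1 - g₁) * (1 - g₃)
          + g₃ * g₄ * g₅ * (1 - g₁) * (1 - g₂)) with hU3
  set U4 := (g₁ * g₂ * g₃ * g₄ * (1 - g₅) + g₁ * g₂ * g₃ * g₅ * (1 - g₄) + g₁ * g₂ * g₄ * g₅ * (1 - g₃) + g₁ * g₃ * g₄ * g₅ * (1 - g₂)
          + g₂ * g₃ * g₄ * g₅ * (1 - g₁)) with hU4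
  clear_value c U0 U1 U2 U3 U4
  have hS2 : 5 * c + 2 ≤ g₁ + g₂ + g₃ + g₄ + g₅ := by
    have : (5 * c + 2) * K ≤ (g₁ + g₂ + g₃ + g₄ + g₅) * K := by linarith [hcK]
    exact le_of_mul_le_mul_right this hK
  have hG := quintHub_coreG g₁ g₂ g₃ g₄ g₅ c hc4 hc2 h1 h2 h3 h4 h5 h11 h21 h31 h41 h51 hS2
  rw [← hU0, ← hU4] at hG
  set Sv : ℝ := g₁ + g₂ + g₃ + g₄ + g₅ - 5 * c with hSv
  have hdS : D ≤ K * Sv := by rw [hSv]; linarith [hcK]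
  have eG : (Sv + 10 * c) * U0 ≤ (5 - 5 * c - Sv) * U4 := by
    have e1 : Sv + 10 * c = g₁ + g₂ + g₃ + g₄ + g₅ + 5 * c := by rw [hSv]; ring
    have e2 : 5 - 5 * c - Sv = 5 - (g₁ + g₂ + g₃ + g₄ + g₅) := by rw [hSv]; ring
    rw [e1, e2]; exact hG
  have hS0 : 2 ≤ Sv := by rw [hSv]; linarith
  have hS5 : Sv ≤ 5 - 5 * c := by rw [hSv]; linarith
  have hpoly : Sv * (5 - 5 * c - Sv) ≤ (4 - Sv) * (Sv + 10 * c) := by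
    have k : Sv * (1 + 5 * c) ≤ (5 - 5 * c) * (1 + 5 * c) := mul_le_mul_of_nonneg_right hS5 (by linarith)
    have kc : 0 ≤ (5 * c - 1) * (c + 1) := mul_nonneg (by linarith) (by linarith)
    linarith
  have hA0 : 0 < Sv + 10 * c := by linarith
  have k1' := mul_le_mul_of_nonneg_left eG (by linarith : (0:ℝ) ≤ Sv)
  have k1 : (Sv + 10 * c) * (Sv * U0) ≤ Sv * ((5 - 5 * c - Sv) * U4) := by linarith [k1']
  have k2' := mul_le_mul_of_nonneg_right hpoly n4
  have k2 : Sv * ((5 - 5 * c - Sv) * U4) ≤ (4 - Sv) * (Sv + 10 * c) * U4 := by linarith [k2']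
  have k3 : (Sv + 10 * c) * (Sv * U0) ≤ (Sv + 10 * c) * ((4 - Sv) * U4) := by linarith
  have k4 : Sv * U0 ≤ (4 - Sv) * U4 := le_of_mul_le_mul_left k3 hA0
  have h6 := mul_le_mul_of_nonneg_right hdS n0
  have h7 := mul_le_mul_of_nonneg_left k4 hK.le
  have h8 : (K * (4 - Sv)) * U4 ≤ (4 * K - D) * U4 := mul_le_mul_of_nonneg_right (by linarith) n4
  linarith [h6, h7, h8]

set_option maxHeartbeats 800000 in
/-- **floor capacity of `5lo+K → 5lo+3K`** (two-low regime): `(D + 10lo)(u₁+u₃) ≤ 5(lo+K)·u₃` (core E at the worst credit). [this work] -/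
theorem quintHub_capEK (lo K g₁ g₂ g₃ g₄ g₅ D : ℝ) (hlo : 0 < lo) (hK2 : 2 * lo ≤ K) (hK8 : K ≤ 4 * lo)
    (hg₁ : lo ≤ K * g₁) (hg₂ : lo ≤ K * g₂) (hg₃ : lo ≤ K * g₃) (hg₄ : lo ≤ K * g₄) (hg₅ : lo ≤ K * g₅)
    (h11 : g₁ ≤ 1) (h21 : g₂ ≤ 1) (h31 : g₃ ≤ 1) (h41 : g₄ ≤ 1) (h51 : g₅ ≤ 1)
    (hD2 : 2 * K ≤ D) (hDS : D ≤ K * (g₁ + g₂ + g₃ + g₄ + g₅) - 5 * lo) :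
    (D + 10 * lo) * ((g₁ * (1 - g₂) * (1 - g₃) * (1 - g₄) * (1 - g₅) + g₂ * (1 - g₁) * (1 - g₃) * (1 - g₄) * (1 - g₅)
          + g₃ * (1 - g₁) * (1 - g₂) * (1 - g₄) * (1 - g₅) + g₄ * (1 - g₁) * (1 - g₂) * (1 - g₃) * (1 - g₅)
          + g₅ * (1 - g₁) * (1 - g₂) * (1 - g₃) * (1 - g₄))
        + (g₁ * g₂ * g₃ * (1 - g₄) * (1 - g₅) + g₁ * g₂ * g₄ * (1 - g₃) * (1 - g₅) + g₁ * g₂ * g₅ * (1 - g₃) * (1 - g₄)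
          + g₁ * g₃ * g₄ * (1 - g₂) * (1 - g₅) + g₁ * g₃ * g₅ * (1 - g₂) * (1 - g₄) + g₁ * g₄ * g₅ * (1 - g₂) * (1 - g₃)
          + g₂ * g₃ * g₄ * (1 - g₁) * (1 - g₅) + g₂ * g₃ * g₅ * (1 - g₁) * (1 - g₄) + g₂ * g₄ * g₅ * (1 - g₁) * (1 - g₃)
          + g₃ * g₄ * g₅ * (1 - g₁) * (1 - g₂)))
      ≤ 5 * (lo + K) * (g₁ * g₂ * g₃ * (1 - g₄) * (1 - g₅) + g₁ * g₂ * g₄ * (1 - g₃) * (1 - g₅) + g₁ * g₂ * g₅ * (1 - g₃) * (1 - g₄)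
          + g₁ * g₃ * g₄ * (1 - g₂) * (1 - g₅) + g₁ * g₃ * g₅ * (1 - g₂) * (1 - g₄) + g₁ * g₄ * g₅ * (1 - g₂) * (1 - g₃)
          + g₂ * g₃ * g₄ * (1 - g₁) * (1 - g₅) + g₂ * g₃ * g₅ * (1 - g₁) * (1 - g₄) + g₂ * g₄ * g₅ * (1 - g₁) * (1 - g₃)
          + g₃ * g₄ * g₅ * (1 - g₁) * (1 - g₂)) := by
  have hK : 0 < K := by linarith
  set c : ℝ := lo / K with hc
  have hcK : c * K = lo := by rw [hc]; field_simp
  have hc4 : 1 / 4 ≤ c := by rw [hc, le_div_iff₀ hK]; linarith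
  have hc2 : c ≤ 1 / 2 := by rw [hc, div_le_iff₀ hK]; linarith
  have h1 : c ≤ g₁ := by rw [hc, div_le_iff₀ hK]; linarith
  have h2 : c ≤ g₂ := by rw [hc, div_le_iff₀ hK]; linarith
  have h3 : c ≤ g₃ := by rw [hc, div_le_iff₀ hK]; linarith
  have h4 : c ≤ g₄ := by rw [hc, div_le_iff₀ hK]; linarith
  have h5 : c ≤ g₅ := by rw [hc, div_le_iff₀ hK]; linarith
  have hg1 : 0 ≤ g₁ := le_trans (by rw [hc]; positivity) h1
  have hg2 : 0 ≤ g₂ := le_trans (by rw [hc]; positivity) h2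
  have hg3 : 0 ≤ g₃ := le_trans (by rw [hc]; positivity) h3
  have hg4 : 0 ≤ g₄ := le_trans (by rw [hc]; positivity) h4
  have hg5 : 0 ≤ g₅ := le_trans (by rw [hc]; positivity) h5
  obtain ⟨n0, n1, n2, n3, n4⟩ := quintHub_masses_nonneg g₁ g₂ g₃ g₄ g₅ hg1 hg2 hg3 hg4 hg5 h11 h21 h31 h41 h51
  set U0 := ((1 - g₁) * (1 - g₂) * (1 - g₃) * (1 - g₄) * (1 - g₅)) with hU0
  set U1 := (g₁ * (1 - g₂) * (1 - g₃) * (1 - g₄) * (1 - g₅) + g₂ * (1 - g₁) * (1 - g₃) * (1 - g₄) * (1 - g₅)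
          + g₃ * (1 - g₁) * (1 - g₂) * (1 - g₄) * (1 - g₅) + g₄ * (1 - g₁) * (1 - g₂) * (1 - g₃) * (1 - g₅)
          + g₅ * (1 - g₁) * (1 - g₂) * (1 - g₃) * (1 - g₄)) with hU1
  set U2 := (g₁ * g₂ * (1 - g₃) * (1 - g₄) * (1 - g₅) + g₁ * g₃ * (1 - g₂) * (1 - g₄) * (1 - g₅) + g₁ * g₄ * (1 - g₂) * (1 - g₃) * (1 - g₅)
          + g₁ * g₅ * (1 - g₂) * (1 - g₃) * (1 - g₄) + g₂ * g₃ * (1 - g₁) * (1 - g₄) * (1 - g₅) + g₂ * g₄ * (1 - g₁) * (1 - g₃) * (1 - g₅)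
          + g₂ * g₅ * (1 - g₁) * (1 - g₃) * (1 - g₄) + g₃ * g₄ * (1 - g₁) * (1 - g₂) * (1 - g₅) + g₃ * g₅ * (1 - g₁) * (1 - g₂) * (1 - g₄)
          + g₄ * g₅ * (1 - g₁) * (1 - g₂) * (1 - g₃)) with hU2
  set U3 := (g₁ * g₂ * g₃ * (1 - g₄) * (1 - g₅) + g₁ * g₂ * g₄ * (1 - g₃) * (1 - g₅) + g₁ * g₂ * g₅ * (1 - g₃) * (1 - g₄)
          + g₁ * g₃ * g₄ * (1 - g₂) * (1 - g₅) + g₁ * g₃ * g₅ * (1 - g₂) * (1 - g₄) + g₁ * g₄ * g₅ * (1 - g₂) * (1 - g₃)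
          + g₂ * g₃ * g₄ * (1 - g₁) * (1 - g₅) + g₂ * g₃ * g₅ * (1 - g₁) * (1 - g₄) + g₂ * g₄ * g₅ * (1 - g₁) * (1 - g₃)
          + g₃ * g₄ * g₅ * (1 - g₁) * (1 - g₂)) with hU3
  set U4 := (g₁ * g₂ * g₃ * g₄ * (1 - g₅) + g₁ * g₂ * g₃ * g₅ * (1 - g₄) + g₁ * g₂ * g₄ * g₅ * (1 - g₃) + g₁ * g₃ * g₄ * g₅ * (1 - g₂)
          + g₂ * g₃ * g₄ * g₅ * (1 - g₁)) with hU4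
  clear_value c U0 U1 U2 U3 U4
  have hS2 : 5 * c + 2 ≤ g₁ + g₂ + g₃ + g₄ + g₅ := by
    have : (5 * c + 2) * K ≤ (g₁ + g₂ + g₃ + g₄ + g₅) * K := by linarith [hcK]
    exact le_of_mul_le_mul_right this hK
  have hE := quintHub_coreE g₁ g₂ g₃ g₄ g₅ c hc4 h1 h2 h3 h4 h5 h11 h21 h31 h41 h51 hS2
  rw [← hU1, ← hU3] at hE
  have hDK : D + 10 * lo ≤ K * (g₁ + g₂ + g₃ + g₄ + g₅ + 5 * c) := by linarith [hcK]
  have h6 := mul_le_mul_of_nonneg_right hDK (add_nonneg n1 n3)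
  have h7 := mul_le_mul_of_nonneg_left hE hK.le
  have e : 5 * (lo + K) * U3 = K * ((g₁ + g₂ + g₃ + g₄ + g₅ + 5 * c) * U3) + K * ((5 - (g₁ + g₂ + g₃ + g₄ + g₅)) * U3) := by
    rw [← hcK]; ring
  rw [e]; linarith [h6, h7]

set_option maxHeartbeats 800000 in
/-- **credit capacity of `5lo+K → 5lo+3K`**: `(D − 2K)·u₁ ≤ (4K − D)·u₃` for `2K ≤ D ≤ K·Λ − 5lo` — DERIVED from core E: `u₃/u₁ ≥ (S+10c)/(5−5c−S) ≥
(S−2)/(4−S)` since `S(3+5c) ≤ 10 + 30c`. [this work] -/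
theorem quintHub_capFK (lo K g₁ g₂ g₃ g₄ g₅ D : ℝ) (hlo : 0 < lo) (hK2 : 2 * lo ≤ K) (hK8 : K ≤ 4 * lo)
    (hg₁ : lo ≤ K * g₁) (hg₂ : lo ≤ K * g₂) (hg₃ : lo ≤ K * g₃) (hg₄ : lo ≤ K * g₄) (hg₅ : lo ≤ K * g₅)
    (h11 : g₁ ≤ 1) (h21 : g₂ ≤ 1) (h31 : g₃ ≤ 1) (h41 : g₄ ≤ 1) (h51 : g₅ ≤ 1)
    (hD2 : 2 * K ≤ D) (hDS : D ≤ K * (g₁ + g₂ + g₃ + g₄ + g₅) - 5 * lo) :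
    (D - 2 * K) * (g₁ * (1 - g₂) * (1 - g₃) * (1 - g₄) * (1 - g₅) + g₂ * (1 - g₁) * (1 - g₃) * (1 - g₄) * (1 - g₅)
          + g₃ * (1 - g₁) * (1 - g₂) * (1 - g₄) * (1 - g₅) + g₄ * (1 - g₁) * (1 - g₂) * (1 - g₃) * (1 - g₅)
          + g₅ * (1 - g₁) * (1 - g₂) * (1 - g₃) * (1 - g₄))
      ≤ (4 * K - D) * (g₁ * g₂ * g₃ * (1 - g₄) * (1 - g₅) + g₁ * g₂ * g₄ * (1 - g₃) * (1 - g₅) + g₁ * g₂ * g₅ * (1 - g₃) * (1 - g₄)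
          + g₁ * g₃ * g₄ * (1 - g₂) * (1 - g₅) + g₁ * g₃ * g₅ * (1 - g₂) * (1 - g₄) + g₁ * g₄ * g₅ * (1 - g₂) * (1 - g₃)
          + g₂ * g₃ * g₄ * (1 - g₁) * (1 - g₅) + g₂ * g₃ * g₅ * (1 - g₁) * (1 - g₄) + g₂ * g₄ * g₅ * (1 - g₁) * (1 - g₃)
          + g₃ * g₄ * g₅ * (1 - g₁) * (1 - g₂)) := by
  have hK : 0 < K := by linarith
  set c : ℝ := lo / K with hc
  have hcK : c * K = lo := by rw [hc]; field_simp
  have hc4 : 1 / 4 ≤ c := by rw [hc, le_div_iff₀ hK]; linarith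
  have hc2 : c ≤ 1 / 2 := by rw [hc, div_le_iff₀ hK]; linarith
  have h1 : c ≤ g₁ := by rw [hc, div_le_iff₀ hK]; linarith
  have h2 : c ≤ g₂ := by rw [hc, div_le_iff₀ hK]; linarith
  have h3 : c ≤ g₃ := by rw [hc, div_le_iff₀ hK]; linarith
  have h4 : c ≤ g₄ := by rw [hc, div_le_iff₀ hK]; linarith
  have h5 : c ≤ g₅ := by rw [hc, div_le_iff₀ hK]; linarith
  have hg1 : 0 ≤ g₁ := le_trans (by rw [hc]; positivity) h1
  have hg2 : 0 ≤ g₂ := le_trans (by rw [hc]; positivity) h2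
  have hg3 : 0 ≤ g₃ := le_trans (by rw [hc]; positivity) h3
  have hg4 : 0 ≤ g₄ := le_trans (by rw [hc]; positivity) h4
  have hg5 : 0 ≤ g₅ := le_trans (by rw [hc]; positivity) h5
  obtain ⟨n0, n1, n2, n3, n4⟩ := quintHub_masses_nonneg g₁ g₂ g₃ g₄ g₅ hg1 hg2 hg3 hg4 hg5 h11 h21 h31 h41 h51
  set U0 := ((1 - g₁) * (1 - g₂) * (1 - g₃) * (1 - g₄) * (1 - g₅)) with hU0
  set U1 := (g₁ * (1 - g₂) * (1 - g₃) * (1 - g₄) * (1 - g₅) + g₂ * (1 - g₁) * (1 - g₃) * (1 - g₄) * (1 - g₅)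
          + g₃ * (1 - g₁) * (1 - g₂) * (1 - g₄) * (1 - g₅) + g₄ * (1 - g₁) * (1 - g₂) * (1 - g₃) * (1 - g₅)
          + g₅ * (1 - g₁) * (1 - g₂) * (1 - g₃) * (1 - g₄)) with hU1
  set U2 := (g₁ * g₂ * (1 - g₃) * (1 - g₄) * (1 - g₅) + g₁ * g₃ * (1 - g₂) * (1 - g₄) * (1 - g₅) + g₁ * g₄ * (1 - g₂) * (1 - g₃) * (1 - g₅)
          + g₁ * g₅ * (1 - g₂) * (1 - g₃) * (1 - g₄) + g₂ * g₃ * (1 - g₁) * (1 - g₄) * (1 - g₅) + g₂ * g₄ * (1 - g₁) * (1 - g₃) * (1 - g₅)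
          + g₂ * g₅ * (1 - g₁) * (1 - g₃) * (1 - g₄) + g₃ * g₄ * (1 - g₁) * (1 - g₂) * (1 - g₅) + g₃ * g₅ * (1 - g₁) * (1 - g₂) * (1 - g₄)
          + g₄ * g₅ * (1 - g₁) * (1 - g₂) * (1 - g₃)) with hU2
  set U3 := (g₁ * g₂ * g₃ * (1 - g₄) * (1 - g₅) + g₁ * g₂ * g₄ * (1 - g₃) * (1 - g₅) + g₁ * g₂ * g₅ * (1 - g₃) * (1 - g₄)
          + g₁ * g₃ * g₄ * (1 - g₂) * (1 - g₅) + g₁ * g₃ * g₅ * (1 - g₂) * (1 - g₄) + g₁ * g₄ * g₅ * (1 - g₂) * (1 - g₃)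
          + g₂ * g₃ * g₄ * (1 - g₁) * (1 - g₅) + g₂ * g₃ * g₅ * (1 - g₁) * (1 - g₄) + g₂ * g₄ * g₅ * (1 - g₁) * (1 - g₃)
          + g₃ * g₄ * g₅ * (1 - g₁) * (1 - g₂)) with hU3
  set U4 := (g₁ * g₂ * g₃ * g₄ * (1 - g₅) + g₁ * g₂ * g₃ * g₅ * (1 - g₄) + g₁ * g₂ * g₄ * g₅ * (1 - g₃) + g₁ * g₃ * g₄ * g₅ * (1 - g₂)
          + g₂ * g₃ * g₄ * g₅ * (1 - g₁)) with hU4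
  clear_value c U0 U1 U2 U3 U4
  have hS2 : 5 * c + 2 ≤ g₁ + g₂ + g₃ + g₄ + g₅ := by
    have : (5 * c + 2) * K ≤ (g₁ + g₂ + g₃ + g₄ + g₅) * K := by linarith [hcK]
    exact le_of_mul_le_mul_right this hK
  have hE := quintHub_coreE g₁ g₂ g₃ g₄ g₅ c hc4 h1 h2 h3 h4 h5 h11 h21 h31 h41 h51 hS2
  rw [← hU1, ← hU3] at hE
  set Sv : ℝ := g₁ + g₂ + g₃ + g₄ + g₅ - 5 * c with hSv
  have hdS : D ≤ K * Sv := by rw [hSv]; linarith [hcK]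
  have eE : (Sv + 10 * c) * U1 ≤ (5 - 5 * c - Sv) * U3 := by
    have e1 : Sv + 10 * c = g₁ + g₂ + g₃ + g₄ + g₅ + 5 * c := by rw [hSv]; ring
    have e2 : 5 - 5 * c - Sv = 5 - (g₁ + g₂ + g₃ + g₄ + g₅) := by rw [hSv]; ring
    rw [e1, e2]; exact hE
  have hS0 : 2 ≤ Sv := by rw [hSv]; linarith
  have hS5 : Sv ≤ 5 - 5 * c := by rw [hSv]; linarith
  have hpoly : (Sv - 2) * (5 - 5 * c - Sv) ≤ (4 - Sv) * (Sv + 10 * c) := by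
    have k : Sv * (3 + 5 * c) ≤ (5 - 5 * c) * (3 + 5 * c) := mul_le_mul_of_nonneg_right hS5 (by linarith)
    have kc : 0 ≤ (5 * c - 1) * (c + 1) := mul_nonneg (by linarith) (by linarith)
    linarith
  have hA0 : 0 < Sv + 10 * c := by linarith
  have k1' := mul_le_mul_of_nonneg_left eE (by linarith : (0:ℝ) ≤ Sv - 2)
  have k1 : (Sv + 10 * c) * ((Sv - 2) * U1) ≤ (Sv - 2) * ((5 - 5 * c - Sv) * U3) := by linarith [k1']
  have k2' := mul_le_mul_of_nonneg_right hpoly n3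
  have k2 : (Sv - 2) * ((5 - 5 * c - Sv) * U3) ≤ (4 - Sv) * (Sv + 10 * c) * U3 := by linarith [k2']
  have k3 : (Sv + 10 * c) * ((Sv - 2) * U1) ≤ (Sv + 10 * c) * ((4 - Sv) * U3) := by linarith
  have k4 : (Sv - 2) * U1 ≤ (4 - Sv) * U3 := le_of_mul_le_mul_left k3 hA0
  have h6 : (D - 2 * K) * U1 ≤ (K * (Sv - 2)) * U1 := mul_le_mul_of_nonneg_right (by linarith) n1
  have h7 := mul_le_mul_of_nonneg_left k4 hK.le
  have h8 : (K * (4 - Sv)) * U3 ≤ (4 * K - D) * U3 := mul_le_mul_of_nonneg_right (by linarith) n3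
  linarith [h6, h7, h8]

end LawDec
end Quant
end Summit.CriticalPhenomena.PercolationContinuityZ3.Theorems
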